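import Mathlib
import Summits.KontsevichZagierPeriods.KontsevichZagierPeriods.Theorems.SoloInformedScaleMaps
import HarnessLib
import HarnessLib.Audit

/-!
# SoloInformed — the scale band step: integrability of the `B`-side from the `A`-side

Solo programme `solo-KontsevichZagierPeriods-informed`, session s50 (PROGRAMME LIII, file F2).

The datum `SoloInformedScaleDatum` of the scale band step (THEOREM XLIX,
`SoloInformedScaleDatum.scale`: `[D ∩ {ω < xᵢ}, Φ/(C(1−ω))] − [D, (Φ − ωΦ(·|xᵢ ↦ ωxᵢ))/(C(1−ω))]
∈ KZ.relations`) carries the integrability of the `B`-integrand as a FIELD, and derives that of the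
`A`-integrand (`SoloInformedScaleDatum.integrableOn_fA`).  When the step is ITERATED (the hook
identities of Kaneko–Yamamoto, `l = (1,…,1)`: PROGRAMME LIII) the natural input is the other one:
the `A`-side of step `s + 1` is the `B`-side of step `s`, and the first `A`-side is a sum of cube
integrals of admissible words.  This file supplies the converse transfer, by the same two
Fubini–Tonelli passes through the band `{(z,λ)}` and the measure-preserving swap `zᵢ ↔ λ`
(`soloInformed_integrableOn_band`, `soloInformed_integrableOn_base`, the null walls of
`SoloInformedScaleMaps`), now read in the order `A → M → N → B`:

* `SoloInformedScalePre n`: the datum WITHOUT the integrability field;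
* `SoloInformedScalePre.integrableOn_fB`: `f_A ∈ L¹(D ∩ {ω < xᵢ}) ⟹ f_B ∈ L¹(D)`;
* `SoloInformedScalePre.toDatum`: the resulting `SoloInformedScaleDatum` (so that `.scale` applies).

The `P`-independent measure theory (measurability of the sets, the null walls) is read off the
auxiliary datum `T₀ = (i, 0, Q, Ω, C, D)`, whose `B`-integrand is `0`.

Place in the programme (the files that consume this one): `SoloInformedHookStage` (one stage of
the hook scale chain is a `SoloInformedScalePre` with its `next`), then `SoloInformedHookChain`
(induction on the number of hanging variables, using `SoloInformedScaleStep`), `SoloInformedHookB`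
(integrability from the back, `SoloInformedScalePre.ofB`) and `SoloInformedHook`.

References: Kontsevich–Zagier 2001 §1.2 rules (1)–(3) [KontsevichZagier2001]; M. Kaneko,
S. Yamamoto, arXiv:1605.03117, Prop. 5.4 and Thm 4.1.
-/

noncomputable section

open MeasureTheory Set MvPolynomial
open Literature.ModelTheory.ExponentialFields Literature.NumberTheory.Transcendental
open Literature.NumberTheory.Transcendental.KZ

namespace Summit.KontsevichZagierPeriods.KontsevichZagierPeriods.Theorems

/-- **The datum of a scale-band step without its integrability field** (cf.
`SoloInformedScaleDatum`): active coordinate `i`, `Φ = P/Q`, passive `Ω, C` free of `Xᵢ`, a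
semialgebraic cylinder `D` over `xᵢ ∈ (0,1)` with `0 < ω < 1`, `C > 0`, `Q ≠ 0` along the closed
active fibres, and `t ↦ tΦ(x|xᵢ ↦ t)` monotone on `[0,1]`. -/
structure SoloInformedScalePre (n : ℕ) where
  /-- the active coordinate -/
  i : Fin n
  /-- numerator of `Φ` -/
  P : MvPolynomial (Fin n) ℚ
  /-- denominator of `Φ` -/
  Q : MvPolynomial (Fin n) ℚ
  /-- the passive polynomial `ω` -/
  Ω : MvPolynomial (Fin n) ℚ
  /-- the passive polynomial `C`; the integrands carry `1/C` -/
  C : MvPolynomial (Fin n) ℚ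
  /-- the cylinder -/
  D : Set (Fin n → ℝ)
  /-- `D` is `ℚ`-semialgebraic -/
  isSemialgebraic_D : IsSemialgebraic ℚ D
  /-- `D` is invariant under moving the active coordinate inside `(0,1)` -/
  update_mem : ∀ x ∈ D, ∀ t : ℝ, 0 < t → t < 1 → Function.update x i t ∈ D
  /-- on `D` the active coordinate lies in `(0,1)` -/
  mem_Ioo : ∀ x ∈ D, 0 < x i ∧ x i < 1
  /-- `Ω` does not involve `Xᵢ` -/
  vars_Ω : i ∉ Ω.vars
  /-- `C` does not involve `Xᵢ` -/
  vars_C : i ∉ C.vars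
  /-- `0 < ω < 1` on `D` -/
  Ω_bound : ∀ x ∈ D, 0 < (aeval x Ω : ℝ) ∧ (aeval x Ω : ℝ) < 1
  /-- `C > 0` on `D` -/
  C_pos : ∀ x ∈ D, 0 < (aeval x C : ℝ)
  /-- `Q ≠ 0` on the closed active fibres -/
  Q_ne : ∀ x ∈ D, ∀ t ∈ Icc (0 : ℝ) 1, (aeval (Function.update x i t) Q : ℝ) ≠ 0
  /-- `t ↦ t·Φ(x|xᵢ ↦ t)` is monotone on `[0,1]` -/
  mono : ∀ x ∈ D, MonotoneOn (fun t : ℝ =>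
    t * ((aeval (Function.update x i t) P : ℝ) / aeval (Function.update x i t) Q)) (Icc 0 1)

namespace SoloInformedScalePre

variable {n : ℕ} (S : SoloInformedScalePre n)

/-! ## 1. The auxiliary datum `T₀ = (i, 0, Q, Ω, C, D)` -/

/-- The auxiliary datum with numerator `0`: its `B`-integrand vanishes, so it is a genuine
`SoloInformedScaleDatum`; it carries the sets `D, D_A`, the bands, the swap and their measure
theory, none of which involve `P`. -/
def T₀ : SoloInformedScaleDatum n where
  i := S.i
  P := 0
  Q := S.Q
  Ω := S.Ω
  C := S.C
  D := S.D
  isSemialgebraic_D := S.isSemialgebraic_D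
  update_mem := S.update_mem
  mem_Ioo := S.mem_Ioo
  vars_Ω := S.vars_Ω
  vars_C := S.vars_C
  Ω_bound := S.Ω_bound
  C_pos := S.C_pos
  Q_ne := S.Q_ne
  mono x _ := by
    simp only [map_zero, zero_div, mul_zero]
    exact monotoneOn_const
  integrableOn_fB := by
    have h : soloInformedScaleFB S.i (0 : MvPolynomial (Fin n) ℚ) S.Q S.Ω S.C = fun _ => 0 := by
      funext x
      simp [soloInformedScaleFB]
    rw [h]
    exact integrableOn_zero

/-- Auxiliary (scale pre-datum): `T₀_i`. -/
@[simp] theorem T₀_i : S.T₀.i = S.i := rfl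
/-- Auxiliary (scale pre-datum): `T₀_Q`. -/
@[simp] theorem T₀_Q : S.T₀.Q = S.Q := rfl
/-- Auxiliary (scale pre-datum): `T₀_Ω`. -/
@[simp] theorem T₀_Ω : S.T₀.Ω = S.Ω := rfl
/-- Auxiliary (scale pre-datum): `T₀_C`. -/
@[simp] theorem T₀_C : S.T₀.C = S.C := rfl
/-- Auxiliary (scale pre-datum): `T₀_D`. -/
@[simp] theorem T₀_D : S.T₀.D = S.D := rfl

/-! ## 2. The functions (as in `SoloInformedScaleDatum`, with numerator `P`) -/

/-- `Φ = P/Q`. -/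
def φ (x : Fin n → ℝ) : ℝ := (aeval x S.P : ℝ) / aeval x S.T₀.Q
/-- `∂Φ/∂xᵢ = (Q ∂ᵢP − P ∂ᵢQ)/Q²`. -/
def φ' (x : Fin n → ℝ) : ℝ :=
  ((aeval x S.T₀.Q : ℝ) * aeval x (pderiv S.T₀.i S.P) -
      aeval x S.P * aeval x (pderiv S.T₀.i S.T₀.Q)) / aeval x S.T₀.Q ^ 2
/-- `f_A = Φ/(C(1 − ω))`. -/
def fA (x : Fin n → ℝ) : ℝ := S.φ x / (S.T₀.cc x * (1 - S.T₀.ω x))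
/-- `f_B = (Φ(x) − ωΦ(x|xᵢ ↦ ωxᵢ))/(C(1 − ω))`. -/
def fB : (Fin n → ℝ) → ℝ := soloInformedScaleFB S.T₀.i S.P S.T₀.Q S.T₀.Ω S.T₀.C
/-- The primitive `F(y, λ) = λ Φ(y|yᵢ ↦ λyᵢ)/(C(y)(1 − ω(y)))`. -/
def F (w : Fin (n + 1) → ℝ) : ℝ :=
  w (Fin.last n) * S.φ (S.T₀.pt w) / (S.T₀.cc (Fin.init w) * (1 - S.T₀.ω (Fin.init w)))
/-- The band integrand `g = ∂F/∂λ`. -/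
def g (w : Fin (n + 1) → ℝ) : ℝ :=
  (S.φ (S.T₀.pt w) + w (Fin.last n) * Fin.init w S.T₀.i * S.φ' (S.T₀.pt w)) /
    (S.T₀.cc (Fin.init w) * (1 - S.T₀.ω (Fin.init w)))

/-- `f_B` unfolded. -/
theorem fB_eq (x : Fin n → ℝ) : S.fB x =
    (S.φ x - S.T₀.ω x * S.φ (Function.update x S.T₀.i (S.T₀.ω x * x S.T₀.i))) /
      (S.T₀.cc x * (1 - S.T₀.ω x)) := rfl

/-- The band integrand is swap-invariant. -/
theorem g_comp_e (w : Fin (n + 1) → ℝ) : S.g (fun j => w (S.T₀.e j)) = S.g w := by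
  simp only [g, SoloInformedScaleDatum.pt_comp_e, SoloInformedScaleDatum.init_comp_e,
    SoloInformedScaleDatum.comp_e_last, Function.update_self, SoloInformedScaleDatum.ω_update,
    congrFun (S.T₀.cc_comp_update _)]
  rw [mul_comm (Fin.init w S.T₀.i)]

/-- Auxiliary (scale pre-datum): `F` on a fibre. -/
theorem F_snoc (y : Fin n → ℝ) (s : ℝ) :
    S.F (Fin.snoc y s) = s * S.φ (Function.update y S.T₀.i (s * y S.T₀.i)) /
      (S.T₀.cc y * (1 - S.T₀.ω y)) := by
  simp [F, SoloInformedScaleDatum.pt_snoc, Fin.init_snoc, Fin.snoc_last]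

/-- Auxiliary (scale pre-datum): `g` on a fibre. -/
theorem g_snoc (y : Fin n → ℝ) (s : ℝ) :
    S.g (Fin.snoc y s) = (S.φ (Function.update y S.T₀.i (s * y S.T₀.i)) +
      s * y S.T₀.i * S.φ' (Function.update y S.T₀.i (s * y S.T₀.i))) /
        (S.T₀.cc y * (1 - S.T₀.ω y)) := by
  simp [g, SoloInformedScaleDatum.pt_snoc, Fin.init_snoc, Fin.snoc_last]

/-- `F(y, 1) − F(y, ω(y)) = f_B(y)`. -/
theorem F_one_sub_F_ω {y : Fin n → ℝ} (hy : y ∈ S.T₀.D) :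
    S.fB y = S.F (Fin.snoc y 1) - S.F (Fin.snoc y (S.T₀.ω y)) := by
  rw [F_snoc, F_snoc, fB_eq, one_mul, one_mul, Function.update_eq_self]
  have hK := SoloInformedScaleDatum.K_pos hy
  field_simp

/-- `F(z, 1) − F(z, 0) = f_A(z)`. -/
theorem F_one_sub_F_zero (z : Fin n → ℝ) :
    S.fA z = S.F (Fin.snoc z 1) - S.F (Fin.snoc z 0) := by
  rw [F_snoc, F_snoc, fA, one_mul, one_mul, Function.update_eq_self]
  simp

/-! ## 3. The fibre calculus (verbatim from `SoloInformedScaleDatum`, numerator `P`) -/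

/-- `∂F/∂λ = g` along the fibres, for `λ ∈ [0,1]` over `y ∈ D`. -/
theorem hasDerivAt_F {y : Fin n → ℝ} (hy : y ∈ S.T₀.D) {t : ℝ} (ht : t ∈ Icc (0 : ℝ) 1) :
    HasDerivAt (fun s : ℝ => S.F (Fin.snoc y s)) (S.g (Fin.snoc y t)) t := by
  have hyi := S.T₀.mem_Ioo y hy
  have hQ : (aeval (Function.update y S.T₀.i (t * y S.T₀.i)) S.T₀.Q : ℝ) ≠ 0 :=
    SoloInformedScaleDatum.q_ne hy (mul_nonneg ht.1 hyi.1.le) (mul_le_one₀ ht.2 hyi.1.le hyi.2.le)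
  have h1 : HasDerivAt (fun s : ℝ => Function.update y S.T₀.i (s * y S.T₀.i))
      ((y S.T₀.i) • Pi.single S.T₀.i (1 : ℝ)) t := by
    have ha : HasDerivAt (fun s : ℝ => s * y S.T₀.i) (y S.T₀.i) t := by
      simpa using (hasDerivAt_id t).mul_const (y S.T₀.i)
    exact (hasDerivAt_update y S.T₀.i (t * y S.T₀.i)).scomp t ha
  have h2 := (soloInformed_hasFDerivAt_aeval_div S.P S.T₀.Q _ hQ).comp_hasDerivAt t h1
  have hval : (∑ j : Fin n, (((aeval (Function.update y S.T₀.i (t * y S.T₀.i)) S.T₀.Q : ℝ) *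
        aeval (Function.update y S.T₀.i (t * y S.T₀.i)) (pderiv j S.P) -
        aeval (Function.update y S.T₀.i (t * y S.T₀.i)) S.P *
        aeval (Function.update y S.T₀.i (t * y S.T₀.i)) (pderiv j S.T₀.Q)) /
        aeval (Function.update y S.T₀.i (t * y S.T₀.i)) S.T₀.Q ^ 2) •
        ContinuousLinearMap.proj (R := ℝ) (φ := fun _ : Fin n => ℝ) j)
        ((y S.T₀.i) • Pi.single S.T₀.i (1 : ℝ)) =
      S.φ' (Function.update y S.T₀.i (t * y S.T₀.i)) * y S.T₀.i := by
    simp [Pi.single_apply, Finset.sum_ite_eq', φ']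
    ring
  have h2' : HasDerivAt (fun s : ℝ => S.φ (Function.update y S.T₀.i (s * y S.T₀.i)))
      (S.φ' (Function.update y S.T₀.i (t * y S.T₀.i)) * y S.T₀.i) t := by
    rw [← hval]
    exact h2
  have h3 : HasDerivAt
      (fun s : ℝ => s * S.φ (Function.update y S.T₀.i (s * y S.T₀.i)) /
        (S.T₀.cc y * (1 - S.T₀.ω y)))
      ((1 * S.φ (Function.update y S.T₀.i (t * y S.T₀.i)) +
        t * (S.φ' (Function.update y S.T₀.i (t * y S.T₀.i)) * y S.T₀.i)) /
          (S.T₀.cc y * (1 - S.T₀.ω y))) t :=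
    ((hasDerivAt_id' t).mul h2').div_const (S.T₀.cc y * (1 - S.T₀.ω y))
  have hfun : (fun s : ℝ => S.F (Fin.snoc y s)) =
      fun s => s * S.φ (Function.update y S.T₀.i (s * y S.T₀.i)) /
        (S.T₀.cc y * (1 - S.T₀.ω y)) := by
    funext s; rw [F_snoc]
  rw [hfun]
  refine h3.congr_deriv ?_
  rw [g_snoc]
  ring

/-- `F` is continuous on the closed fibres `[0,1]` over `D`. -/
theorem continuousOn_F {y : Fin n → ℝ} (hy : y ∈ S.T₀.D) {a b : ℝ} (ha : 0 ≤ a) (hb : b ≤ 1) :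
    ContinuousOn (fun s : ℝ => S.F (Fin.snoc y s)) (Icc a b) := fun _ hs =>
  (S.hasDerivAt_F hy ⟨ha.trans hs.1, hs.2.trans hb⟩).continuousAt.continuousWithinAt

/-- `λ ↦ F(y, λ)` is monotone on `[0,1]`. -/
theorem monotoneOn_F {y : Fin n → ℝ} (hy : y ∈ S.T₀.D) :
    MonotoneOn (fun s : ℝ => S.F (Fin.snoc y s)) (Icc 0 1) := by
  intro s hs s' hs' hss'
  have hyi := S.T₀.mem_Ioo y hy
  have hK := SoloInformedScaleDatum.K_pos hy
  simp only [F_snoc]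
  rw [div_le_div_iff_of_pos_right hK]
  have hm := S.mono y hy ⟨mul_nonneg hs.1 hyi.1.le, mul_le_one₀ hs.2 hyi.1.le hyi.2.le⟩
    ⟨mul_nonneg hs'.1 hyi.1.le, mul_le_one₀ hs'.2 hyi.1.le hyi.2.le⟩
    (mul_le_mul_of_nonneg_right hss' hyi.1.le)
  simp only [φ] at hm ⊢
  refine le_of_mul_le_mul_right ?_ hyi.1
  calc s * ((aeval (Function.update y S.T₀.i (s * y S.T₀.i)) S.P : ℝ) /
        aeval (Function.update y S.T₀.i (s * y S.T₀.i)) S.T₀.Q) * y S.T₀.i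
      = s * y S.T₀.i * ((aeval (Function.update y S.T₀.i (s * y S.T₀.i)) S.P : ℝ) /
        aeval (Function.update y S.T₀.i (s * y S.T₀.i)) S.T₀.Q) := by ring
    _ ≤ s' * y S.T₀.i * ((aeval (Function.update y S.T₀.i (s' * y S.T₀.i)) S.P : ℝ) /
        aeval (Function.update y S.T₀.i (s' * y S.T₀.i)) S.T₀.Q) := hm
    _ = s' * ((aeval (Function.update y S.T₀.i (s' * y S.T₀.i)) S.P : ℝ) /
        aeval (Function.update y S.T₀.i (s' * y S.T₀.i)) S.T₀.Q) * y S.T₀.i := by ring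

/-- `g ≥ 0` on the open fibres `(0,1)` over `D`. -/
theorem g_nonneg {y : Fin n → ℝ} (hy : y ∈ S.T₀.D) {t : ℝ} (ht : t ∈ Ioo (0 : ℝ) 1) :
    0 ≤ S.g (Fin.snoc y t) :=
  soloInformed_deriv_nonneg_of_monotoneOn (S.monotoneOn_F hy) ht.1 ht.2
    (S.hasDerivAt_F hy ⟨ht.1.le, ht.2.le⟩)

/-! ## 4. Measurability of `g` -/

/-- `g` is semialgebraic on the cylinder `{(y,λ) | y ∈ D, 0 ≤ λ ≤ 1}`. -/
theorem isSemialgebraicFunOn_g_cyl : IsSemialgebraicFunOn ℚ S.T₀.cyl S.g := by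
  refine soloInformed_isSemialgebraicFunOn_quot S.T₀.isSemialgebraic_cyl
    (bind₁ S.T₀.vhat S.P * bind₁ S.T₀.vhat S.T₀.Q + X (Fin.last n) * X (Fin.castSucc S.T₀.i) *
      (bind₁ S.T₀.vhat S.T₀.Q * bind₁ S.T₀.vhat (pderiv S.T₀.i S.P) -
        bind₁ S.T₀.vhat S.P * bind₁ S.T₀.vhat (pderiv S.T₀.i S.T₀.Q)))
    (bind₁ S.T₀.vhat S.T₀.Q ^ 2 * rename Fin.castSucc S.T₀.C * (1 - rename Fin.castSucc S.T₀.Ω)) _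
    (fun w hw => ?_) (fun w hw => ?_)
  · obtain ⟨h1, hK⟩ := S.T₀.cyl_ne hw
    have h2 := (S.T₀.C_pos _ hw.1).ne'
    have h3 := (sub_pos.2 (SoloInformedScaleDatum.ω_lt_one hw.1)).ne'
    simp only [SoloInformedScaleDatum.ω] at h3
    simp only [map_mul, map_sub, map_one, map_pow, SoloInformedScaleDatum.aeval_hat,
      soloInformed_aeval_rename_castSucc]
    exact mul_ne_zero (mul_ne_zero (pow_ne_zero 2 h1) h2) h3
  · obtain ⟨h1, hK⟩ := S.T₀.cyl_ne hw
    have h2 := (S.T₀.C_pos _ hw.1).ne'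
    have h3 := (sub_pos.2 (SoloInformedScaleDatum.ω_lt_one hw.1)).ne'
    simp only [SoloInformedScaleDatum.ω] at h3
    simp only [map_mul, map_sub, map_add, map_one, map_pow, SoloInformedScaleDatum.aeval_hat,
      soloInformed_aeval_rename_castSucc, aeval_X, g, φ, φ', SoloInformedScaleDatum.cc,
      SoloInformedScaleDatum.ω]
    have hinit : w (Fin.castSucc S.T₀.i) = Fin.init w S.T₀.i := rfl
    rw [hinit]
    field_simp

/-- `g` is a.e. strongly measurable on `bandM`. -/
theorem aestronglyMeasurable_g_bandM :
    AEStronglyMeasurable S.g (volume.restrict S.T₀.bandM) :=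
  aestronglyMeasurable_of_isSemialgebraicFunOn
    (S.isSemialgebraicFunOn_g_cyl.mono S.T₀.bandM_subset_cyl S.T₀.isSemialgebraic_bandM)
    S.T₀.measurableSet_bandM

/-! ## 5. The transfer `A → M → N → B` -/

/-- **Tonelli:** `f_A ∈ L¹(D_A) ⟹ g ∈ L¹(bandM)` (`g ≥ 0`, fibre integrals `F(z,1) − F(z,0) = f_A`). -/
theorem integrableOn_g_bandM (hA : IntegrableOn S.fA S.T₀.DA) : IntegrableOn S.g S.T₀.bandM :=
  soloInformed_integrableOn_band (τ := S.T₀.DA) (a := fun _ => (0 : ℝ)) (b := fun _ => (1 : ℝ))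
    (F := S.F) (g := S.g) S.T₀.measurableSet_DA S.T₀.measurableSet_bandM rfl
    (fun _ _ => zero_le_one)
    (fun _ hx => S.continuousOn_F hx.1 le_rfl le_rfl)
    (fun _ hx _ ht => S.hasDerivAt_F hx.1 ⟨le_of_lt ht.1, le_of_lt ht.2⟩)
    (fun _ hx _ ht => S.g_nonneg hx.1 ⟨ht.1, ht.2⟩)
    S.aestronglyMeasurable_g_bandM
    (hA.congr_fun (fun x _ => S.F_one_sub_F_zero x) S.T₀.measurableSet_DA)

/-- **Swap:** `g ∈ L¹(bandM) ⟹ g ∈ L¹(bandN)` (measure-preserving `zᵢ ↔ λ`, `g` invariant, the two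
bands agreeing up to the null walls of `SoloInformedScaleMaps`). -/
theorem integrableOn_g_bandN (hM : IntegrableOn S.g S.T₀.bandM) : IntegrableOn S.g S.T₀.bandN := by
  have hW : MeasurePreserving (MeasurableEquiv.piCongrLeft (fun _ : Fin (n + 1) => ℝ) S.T₀.e.symm)
      (volume : Measure (Fin (n + 1) → ℝ)) (volume : Measure (Fin (n + 1) → ℝ)) :=
    volume_measurePreserving_piCongrLeft (fun _ : Fin (n + 1) => ℝ) S.T₀.e.symm
  have happ : ∀ w : Fin (n + 1) → ℝ,
      MeasurableEquiv.piCongrLeft (fun _ : Fin (n + 1) => ℝ) S.T₀.e.symm w =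
        fun j => w (S.T₀.e j) := by
    intro w; ext j
    simpa using MeasurableEquiv.piCongrLeft_apply_apply S.T₀.e.symm
      (β := fun _ : Fin (n + 1) => ℝ) w (S.T₀.e j)
  have hpre : (MeasurableEquiv.piCongrLeft (fun _ : Fin (n + 1) => ℝ) S.T₀.e.symm) ⁻¹' S.T₀.bandM =
      {w | (fun j => w (S.T₀.e j)) ∈ S.T₀.bandM} := by
    ext w; rw [mem_preimage, happ]; rfl
  have hcomp : S.g ∘ (MeasurableEquiv.piCongrLeft (fun _ : Fin (n + 1) => ℝ) S.T₀.e.symm) = S.g := by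
    funext w; rw [Function.comp_apply, happ, g_comp_e]
  have hae : {w : Fin (n + 1) → ℝ | (fun j => w (S.T₀.e j)) ∈ S.T₀.bandM} =ᵐ[volume] S.T₀.bandN :=
    ae_eq_set.2 ⟨S.T₀.null_M_diff_N, S.T₀.null_N_diff_M⟩
  have h2 : IntegrableOn
      (S.g ∘ (MeasurableEquiv.piCongrLeft (fun _ : Fin (n + 1) => ℝ) S.T₀.e.symm))
      ((MeasurableEquiv.piCongrLeft (fun _ : Fin (n + 1) => ℝ) S.T₀.e.symm) ⁻¹' S.T₀.bandM) :=
    (hW.integrableOn_comp_preimage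
      (MeasurableEquiv.piCongrLeft (fun _ : Fin (n + 1) => ℝ) S.T₀.e.symm).measurableEmbedding).mpr hM
  rw [hcomp, hpre] at h2
  exact h2.congr_set_ae hae.symm

/-- **Fubini:** `g ∈ L¹(bandN) ⟹ f_B ∈ L¹(D)` (fibre integrals `F(y,1) − F(y,ω(y)) = f_B(y)`). -/
theorem integrableOn_fB_of_bandN (hN : IntegrableOn S.g S.T₀.bandN) : IntegrableOn S.fB S.T₀.D :=
  soloInformed_integrableOn_base (τ := S.T₀.D) (B := S.T₀.bandN) (a := S.T₀.ω)
    (b := fun _ => (1 : ℝ)) (F := S.F) (g := S.g) (f := S.fB)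
    S.T₀.measurableSet_D S.T₀.measurableSet_bandN rfl
    (fun _ hx => (SoloInformedScaleDatum.ω_lt_one hx).le)
    (fun _ hx => S.continuousOn_F hx (SoloInformedScaleDatum.ω_pos hx).le le_rfl)
    (fun _ hx _ ht => S.hasDerivAt_F hx
      ⟨(SoloInformedScaleDatum.ω_pos hx).le.trans (le_of_lt ht.1), le_of_lt ht.2⟩)
    hN (fun _ hx => S.F_one_sub_F_ω hx)

/-- **INTEGRABILITY OF THE `B`-SIDE FROM THE `A`-SIDE.**  For a scale pre-datum, if
`f_A = Φ/(C(1−ω))` is integrable on `D ∩ {ω < xᵢ}` then `f_B = (Φ − ωΦ(·|xᵢ ↦ ωxᵢ))/(C(1−ω))` is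
integrable on `D` (Tonelli up the band over `D_A`, swap, Fubini down the band over `D`). -/
theorem integrableOn_fB (hA : IntegrableOn S.fA S.T₀.DA) : IntegrableOn S.fB S.T₀.D :=
  S.integrableOn_fB_of_bandN (S.integrableOn_g_bandN (S.integrableOn_g_bandM hA))

/-! ## 6. The datum -/

/-- **The scale datum of a pre-datum with integrable `A`-side.** -/
def toDatum (hA : IntegrableOn S.fA S.T₀.DA) : SoloInformedScaleDatum n where
  i := S.i
  P := S.P
  Q := S.Q
  Ω := S.Ω
  C := S.C
  D := S.D
  isSemialgebraic_D := S.isSemialgebraic_D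
  update_mem := S.update_mem
  mem_Ioo := S.mem_Ioo
  vars_Ω := S.vars_Ω
  vars_C := S.vars_C
  Ω_bound := S.Ω_bound
  C_pos := S.C_pos
  Q_ne := S.Q_ne
  mono := S.mono
  integrableOn_fB := S.integrableOn_fB hA

variable (hA : IntegrableOn S.fA S.T₀.DA)

/-- Auxiliary (scale pre-datum): the `A`-integrand of the datum is `f_A`. -/
theorem toDatum_fA : (S.toDatum hA).fA = S.fA := rfl
/-- Auxiliary (scale pre-datum): the `B`-integrand of the datum is `f_B`. -/
theorem toDatum_fB : (S.toDatum hA).fB = S.fB := rfl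

end SoloInformedScalePre

end Summit.KontsevichZagierPeriods.KontsevichZagierPeriods.Theorems
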